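import Literature.Barriers.ValiantsHypothesis.BIJL18Thm4OfPITModP
import Literature.Computability.AlgebraicComplexity.PITLanguageModP
import HarnessLib

/-!
# Bläser–Ikenmeyer–Jindal–Lysikov 2018, Thm 4 — DISCHARGED over every infinite field

Theorem-only closer of the typed fact `BIJL2018_thm4 K` (`BIJL18MatrixCompletion.lean`; ECCC
TR18-064 Thm 4: "For infinitely many `n`, there is an `m`, a tensor `t ∈ K^{n×n×m}` with coefficients
in `{−1, 0, 1}`, and a value `r` such that there is no algebraic `poly(n)`-natural proof for the fact
that `\underline{CR}(t) > r` unless `coNP ⊆ ∃BPP`", `K` any infinite field, §2: "We shall use `K` to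
denote the underlying field … One can think of `K = ℂ`"). The reduction of Thm 4 over an infinite
field of characteristic `p` to a `BPP` identity test for integer circuit words MODULO `p`
(`BIJL18Thm4OfPITModP.lean`, p7 lineage: `BIJL2018Thm4.BIJL2018_thm4_of_randomizedPITMod`, the printed
`∃BPP` verifier —
guess a constant-free circuit, test `p(g) = 0` and `p(T_φ) ≠ 0` by identity testing, Max-2-SAT is
NP-hard — assembled from `BIJL18Thm4VerifierSemantics.lean` (p7 lineage), `BIJL18Thm4Machine.lean`
(x5 lineage) and `BIJL18Thm4OfPIT.lean` (p7 lineage, the characteristic-`0` closer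
`BIJL2018_thm4_charZero`)) meets the tree's identity test modulo the characteristic
(`PITLanguageModP.lean`, t21 lineage: `PITLanguageMod (ringChar K) ∈ BPP` for every field `K` —
integer identity testing in characteristic `0` (Ibarra–Moran / Schwartz–Zippel, `PITLanguageCoRP.lean`),
the randomised extension-field zero test over `𝔽_p` in characteristic `p`
(`RandomizedExtensionFieldZeroTest.lean`, `CircuitCodeExtFieldEvaluator.lean`)). Hence
**`BIJL2018_thm4_holds : ∀ K [Field K] [Infinite K], BIJL2018_thm4 K`** — the fact with exactly its
own binders — and the prime-characteristic instance `BIJL2018Thm4.BIJL2018_thm4_charP`.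

No definitions, no new facts. DEVIATIONS from the printed proof (disclosed in the assembled files):
slice-rank profile `r_k = n` of the Lemma-16 chart (vacuous) instead of `r_k = rk A_k`; instances
below the size threshold of the assumed natural proofs padded by tautological clauses; guessed
circuits as Kabanets–Impagliazzo gate lists; in characteristic `p` the identity test is a one-sided
randomised test over random extensions `𝔽_p[X]/(f)` (the source only says "polynomial identity
testing"). HONEST FRAMING (val-lit): a published CONDITIONAL barrier (antecedent `coNP ⊄ ∃BPP` kept
inside the statement) about the varieties `{\underline{CR} ≤ r}` of border completion rank, now a
theorem of the tree for every infinite field; it says nothing about `VP`, the determinant or the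
permanent, and `VP ≠ VNP` is NOT proved.

## References

* [BlaserIkenmeyerJindalLysikov2018] M. Bläser, C. Ikenmeyer, G. Jindal, V. Lysikov, *Generalized
  matrix completion and algebraic natural proofs*, STOC 2018 / ECCC TR18-064: Thm 4 (statement
  p. 6; proof pp. 11–12), §2, Thm 3, Lemma 14, Lemma 16, Obs. 17.
* [KabanetsImpagliazzo2004] V. Kabanets, R. Impagliazzo, *Derandomizing polynomial identity tests
  means proving circuit lower bounds*, Comput. Complexity 13 (2004), §2.3.
* [AgrawalBiswas2003] M. Agrawal, S. Biswas, *Primality and identity testing via Chinese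
  remaindering*, J. ACM 50 (2003).
-/

namespace Literature.Barriers.ValiantsHypothesis

open Literature.Computability.AlgebraicComplexity

universe u

/-- **BIJL Thm 4 over an infinite field of prime characteristic `p`**: the modular reduction
`BIJL2018_thm4_of_randomizedPITMod` applied to `PITLanguageMod p ∈ BPP` (randomised identity testing
of integer circuits over `𝔽_p` as a polynomial identity).
[cite: BlaserIkenmeyerJindalLysikov2018, Thm. 4] -/
theorem BIJL2018Thm4.BIJL2018_thm4_charP (K : Type u) [Field K] [Infinite K] (p : ℕ) [Fact p.Prime]
    [CharP K p] : BIJL2018_thm4 K :=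
  BIJL2018Thm4.BIJL2018_thm4_of_randomizedPITMod p K (PITLanguageMod_mem_BPP p)
    fun m C _ => circuitWord_mem_PITLanguageMod_iff p m C

/-- **Discharge of `BIJL2018_thm4`** (BIJL Thm 4, every infinite field `K`): the modular reduction
`BIJL2018_thm4_of_randomizedPITMod` at `p = ringChar K` (uniform in the characteristic, `0` included:
`ZMod 0 = ℤ`, `PITLanguageMod 0 = PITLanguage`) applied to the tree's
`PITLanguageMod (ringChar K) ∈ BPP`. The statement is the closed universal closure over the fact's OWN
parameters — the field `K` with its `Field`/`Infinite` instances, exactly the binders of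
`def BIJL2018_thm4` — and carries no hypothesis (same shape as `BILPS2019_cor42_holds`).
[cite: BlaserIkenmeyerJindalLysikov2018, Thm. 4] -/
theorem BIJL2018_thm4_holds : ∀ (K : Type u) [Field K] [Infinite K], BIJL2018_thm4 K :=
  fun K _ _ => BIJL2018Thm4.BIJL2018_thm4_of_randomizedPITMod (ringChar K) K (PITLanguageMod_ringChar_mem_BPP K)
    fun m C _ => circuitWord_mem_PITLanguageMod_iff (ringChar K) m C

end Literature.Barriers.ValiantsHypothesis
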